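import Mathlib
import Summits.CriticalPhenomena.SAWScalingLimit.Theses.SAWEdwardsStrongCoupling
import Summits.CriticalPhenomena.SAWScalingLimit.Theses.SAWCutPointCondensation

/-!
# Support `ScheduleExtraction` (stmt-CriticalPhenomena-4655) — routes SAWEdwardsStrongCoupling and SAWCutPointCondensation

The item is shared verbatim by the two routes; `scheduleExtraction_proof` proves the decl of
route SAWEdwardsStrongCoupling and `scheduleExtraction_cutPointCondensation_proof` the identical
decl of route SAWCutPointCondensation.

Diagonal schedule for iterated weak limits of probability laws on the curve space
`CurveClass ℂ`: if `F g δ ⇒ A g` as `δ → 0⁺` for every `g > 0` and `A g ⇒ P` as `g → ∞`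
(bounded continuous test functions, all `A g` and `P` probability measures, each `F g δ` either
the zero measure or a probability measure), then along some schedule `gs δ → ∞` one has
`F (gs δ) δ ⇒ P` as `δ → 0⁺`.

Proof. The space `ProbabilityMeasure (CurveClass ℂ)` with the topology of weak convergence is
metrisable (Lévy–Prokhorov, Mathlib `MeasureTheory.instMetrizableSpaceProbabilityMeasure`), in
particular first countable, so `𝓝 P` has an antitone countable basis `U n`. Choose `g n ≥ n + 1`
with `A (g n) ∈ interior (U n)`, then `ε n > 0` with `F (g n) δ ∈ interior (U n)` (and `F (g n) δ`
a probability measure) for all `δ ∈ (0, ε n)`, and put `gs δ := g (N δ - 1)` where `N δ` is the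
least index with `min (ε N) (1/(N+1)) ≤ δ`. The purely topological extraction is
`exists_schedule_of_tendsto` below (Billingsley, *Convergence of probability measures*, 2nd ed.
1999, §1.2 and Thm 6.8 for the metrisability that makes the diagonal argument available).
-/

namespace Summit.CriticalPhenomena.SAWScalingLimit.Theorems

open Filter Set MeasureTheory
open scoped Topology

/-- **Diagonal schedule (topological core).** Let `y` be a point of a first countable space,
`a : ℝ → Y` with `a g → y` as `g → ∞`, and for every `g > 0` let `Φ g δ → a g` as `δ → 0⁺` while a
side condition `Q g δ` holds for all small `δ > 0`. Then there is a schedule `gs : ℝ → ℝ` with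
`gs δ → ∞`, `Φ (gs δ) δ → y` and `Q (gs δ) δ` eventually, as `δ → 0⁺`. -/
theorem exists_schedule_of_tendsto {Y : Type*} [TopologicalSpace Y] {y : Y}
    [(𝓝 y).IsCountablyGenerated] {Φ : ℝ → ℝ → Y} {a : ℝ → Y} {Q : ℝ → ℝ → Prop}
    (h1 : ∀ g : ℝ, 0 < g → Tendsto (Φ g) (𝓝[>] 0) (𝓝 (a g)))
    (hQ : ∀ g : ℝ, 0 < g → ∀ᶠ δ in 𝓝[>] 0, Q g δ)
    (h2 : Tendsto a atTop (𝓝 y)) :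
    ∃ gs : ℝ → ℝ, Tendsto gs (𝓝[>] 0) atTop ∧
      Tendsto (fun δ => Φ (gs δ) δ) (𝓝[>] 0) (𝓝 y) ∧ ∀ᶠ δ in 𝓝[>] 0, Q (gs δ) δ := by
  classical
  obtain ⟨U, hU⟩ := (𝓝 y).exists_antitone_basis
  -- Step 1: couplings `g n ≥ n + 1` with `a (g n) ∈ interior (U n)`.
  have hg : ∀ n : ℕ, ∃ g : ℝ, (n : ℝ) + 1 ≤ g ∧ a g ∈ interior (U n) := fun n => by
    have h : ∀ᶠ g in atTop, (n : ℝ) + 1 ≤ g ∧ a g ∈ interior (U n) :=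
      (eventually_ge_atTop _).and (h2 (interior_mem_nhds.2 (hU.mem n)))
    exact h.exists
  choose g hg_ge hg_mem using hg
  have hg_pos : ∀ n, 0 < g n := fun n => lt_of_lt_of_le (by positivity) (hg_ge n)
  -- Step 2: thresholds `ε n > 0` below which `Φ (g n) δ ∈ interior (U n)` and `Q (g n) δ`.
  have hε : ∀ n : ℕ, ∃ ε : ℝ, 0 < ε ∧
      ∀ δ ∈ Ioo 0 ε, Φ (g n) δ ∈ interior (U n) ∧ Q (g n) δ := fun n => by
    have hmem : {δ : ℝ | Φ (g n) δ ∈ interior (U n) ∧ Q (g n) δ} ∈ 𝓝[>] (0 : ℝ) :=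
      ((h1 (g n) (hg_pos n)).eventually
        (isOpen_interior.mem_nhds (hg_mem n))).and (hQ (g n) (hg_pos n))
    obtain ⟨u, hu, hsub⟩ := mem_nhdsGT_iff_exists_Ioo_subset.1 hmem
    exact ⟨u, hu, fun δ hδ => hsub hδ⟩
  choose ε hε_pos hε_spec using hε
  -- Step 3: the schedule. `ε' n := min (ε n) (1/(n+1))`, `N δ :=` least `n` with `ε' n ≤ δ`.
  set ε' : ℕ → ℝ := fun n => min (ε n) (1 / ((n : ℝ) + 1)) with hε'_def
  have hε'_pos : ∀ n, 0 < ε' n := fun n => lt_min (hε_pos n) (by positivity)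
  have hex : ∀ δ : ℝ, 0 < δ → ∃ n : ℕ, ε' n ≤ δ := fun δ hδ => by
    obtain ⟨n, hn⟩ := exists_nat_one_div_lt hδ
    exact ⟨n, (min_le_right _ _).trans hn.le⟩
  let N : ℝ → ℕ := fun δ => if h : ∃ n : ℕ, ε' n ≤ δ then Nat.find h else 0
  -- below `N δ`, the thresholds are not yet reached
  have hN_lt : ∀ δ : ℝ, 0 < δ → ∀ n, n < N δ → δ < ε' n := fun δ hδ n hn => by
    have h := hex δ hδ
    simp only [N, dif_pos h] at hn
    exact lt_of_not_ge (Nat.find_min h hn)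
  -- `N δ → ∞` as `δ → 0⁺`
  have hN_tendsto : Tendsto N (𝓝[>] 0) atTop := by
    refine tendsto_atTop.2 fun M => ?_
    have hsmall : ∀ᶠ δ in 𝓝[>] (0 : ℝ), ∀ n ∈ Finset.range M, δ < ε' n :=
      (Filter.eventually_all_finset _).2 fun n _ =>
        mem_nhdsWithin_of_mem_nhds (Iio_mem_nhds (hε'_pos n))
    have hpos : ∀ᶠ δ in 𝓝[>] (0 : ℝ), 0 < δ := eventually_mem_nhdsWithin
    filter_upwards [hsmall, hpos] with δ hδ hδpos
    have h := hex δ hδpos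
    simp only [N, dif_pos h]
    by_contra hlt
    have hmem : Nat.find h ∈ Finset.range M := Finset.mem_range.2 (not_le.1 hlt)
    exact absurd (Nat.find_spec h) (not_le.2 (hδ _ hmem))
  refine ⟨fun δ => g (N δ - 1), ?_, ?_, ?_⟩
  · -- `gs δ = g (N δ - 1) ≥ N δ → ∞`
    refine tendsto_atTop_mono (fun δ => ?_)
      (tendsto_natCast_atTop_atTop.comp hN_tendsto)
    have h := hg_ge (N δ - 1)
    simp only [Function.comp_apply]
    calc ((N δ : ℕ) : ℝ) ≤ ((N δ - 1 : ℕ) : ℝ) + 1 := by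
          rcases Nat.eq_zero_or_pos (N δ) with h0 | h0
          · simp [h0]
          · rw [Nat.cast_sub h0]; simp
      _ ≤ g (N δ - 1) := h
  · -- convergence along the antitone basis
    rw [hU.1.tendsto_right_iff]
    intro i _
    have hi : ∀ᶠ δ in 𝓝[>] (0 : ℝ), i + 1 ≤ N δ := hN_tendsto.eventually (eventually_ge_atTop _)
    have hpos : ∀ᶠ δ in 𝓝[>] (0 : ℝ), 0 < δ := eventually_mem_nhdsWithin
    filter_upwards [hi, hpos] with δ hδ hδpos
    have hlt : N δ - 1 < N δ := Nat.sub_lt (by omega) one_pos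
    have h := hN_lt δ hδpos _ hlt
    have hmem := (hε_spec (N δ - 1) δ ⟨hδpos, lt_of_lt_of_le h (min_le_left _ _)⟩).1
    exact hU.antitone (by omega : i ≤ N δ - 1) (interior_subset hmem)
  · have hi : ∀ᶠ δ in 𝓝[>] (0 : ℝ), 1 ≤ N δ := hN_tendsto.eventually (eventually_ge_atTop _)
    have hpos : ∀ᶠ δ in 𝓝[>] (0 : ℝ), 0 < δ := eventually_mem_nhdsWithin
    filter_upwards [hi, hpos] with δ hδ hδpos
    have hlt : N δ - 1 < N δ := Nat.sub_lt (by omega) one_pos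
    have h := hN_lt δ hδpos _ hlt
    exact (hε_spec (N δ - 1) δ ⟨hδpos, lt_of_lt_of_le h (min_le_left _ _)⟩).2

open Literature.Probability.RandomPlanarGeometry in
/-- **`ScheduleExtraction` (route SAWEdwardsStrongCoupling, item stmt-CriticalPhenomena-4655;
shared verbatim with route SAWCutPointCondensation).** Diagonal schedule for iterated weak
limits on `CurveClass ℂ`: if each `F g δ` is `0` or a probability measure, `F g δ ⇒ A g` as
`δ → 0⁺` for every `g > 0`, every `A g` (`g > 0`) and `P` are probability measures and `A g ⇒ P`
as `g → ∞`, then there is `gs : ℝ → ℝ` with `gs δ → ∞` and `F (gs δ) δ ⇒ P` as `δ → 0⁺`.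
Weak convergence of probability measures on the separable metric space `CurveClass ℂ` is
metrisable (Lévy–Prokhorov), so the topological diagonal lemma `exists_schedule_of_tendsto`
applies; `F g δ` is eventually a probability measure by testing against `f ≡ 1`. -/
theorem scheduleExtraction_proof :
    Summit.CriticalPhenomena.SAWScalingLimit.Theses.SAWEdwardsStrongCoupling.ScheduleExtraction := by
  intro F A P hA hP hF hFA hAP
  classical
  -- probability-measure lifts
  set p : ProbabilityMeasure (CurveClass ℂ) := ⟨P, hP⟩ with hp_def
  let a : ℝ → ProbabilityMeasure (CurveClass ℂ) := fun g =>
    if h : 0 < g then ⟨A g, hA g h⟩ else p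
  let Φ : ℝ → ℝ → ProbabilityMeasure (CurveClass ℂ) := fun g δ =>
    if h : IsProbabilityMeasure (F g δ) then ⟨F g δ, h⟩ else p
  have ha : ∀ g, 0 < g → ((a g : ProbabilityMeasure (CurveClass ℂ)) : Measure (CurveClass ℂ)) = A g :=
    fun g hg => by simp only [a, dif_pos hg]; rfl
  have hΦ : ∀ g δ, IsProbabilityMeasure (F g δ) →
      ((Φ g δ : ProbabilityMeasure (CurveClass ℂ)) : Measure (CurveClass ℂ)) = F g δ :=
    fun g δ h => by simp only [Φ, dif_pos h]; rfl
  -- `F g δ` is eventually a probability measure (test against `f ≡ 1`)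
  have hQ : ∀ g : ℝ, 0 < g → ∀ᶠ δ in 𝓝[>] 0, IsProbabilityMeasure (F g δ) := by
    intro g hg
    haveI := hA g hg
    have h1 := hFA g hg (BoundedContinuousFunction.const (CurveClass ℂ) (1 : ℝ))
    have hlim : ∫ _x, (BoundedContinuousFunction.const (CurveClass ℂ) (1 : ℝ)) _x ∂(A g) = 1 := by
      simp
    rw [hlim] at h1
    have hev : ∀ᶠ δ in 𝓝[>] (0 : ℝ),
        (1 / 2 : ℝ) < ∫ x, (BoundedContinuousFunction.const (CurveClass ℂ) (1 : ℝ)) x ∂(F g δ) :=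
      h1.eventually (lt_mem_nhds (by norm_num))
    filter_upwards [hev] with δ hδ
    rcases hF g δ with h0 | hprob
    · rw [h0, integral_zero_measure] at hδ; norm_num at hδ
    · exact hprob
  -- the two convergence hypotheses, lifted to `ProbabilityMeasure`
  have h1 : ∀ g : ℝ, 0 < g → Tendsto (Φ g) (𝓝[>] 0) (𝓝 (a g)) := by
    intro g hg
    rw [ProbabilityMeasure.tendsto_iff_forall_integral_tendsto]
    intro f
    rw [ha g hg]
    refine (hFA g hg f).congr' ?_
    filter_upwards [hQ g hg] with δ hδ
    rw [hΦ g δ hδ]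
  have h2 : Tendsto a atTop (𝓝 p) := by
    rw [ProbabilityMeasure.tendsto_iff_forall_integral_tendsto]
    intro f
    refine (hAP f).congr' ?_
    filter_upwards [eventually_gt_atTop (0 : ℝ)] with g hg
    rw [ha g hg]
  obtain ⟨gs, hgs, hconv, hprob⟩ := exists_schedule_of_tendsto (Q := fun g δ =>
    IsProbabilityMeasure (F g δ)) h1 hQ h2
  refine ⟨gs, hgs, fun f => ?_⟩
  have h := (ProbabilityMeasure.tendsto_iff_forall_integral_tendsto.1 hconv) f
  refine h.congr' ?_
  filter_upwards [hprob] with δ hδ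
  rw [hΦ (gs δ) δ hδ]

/-- **`ScheduleExtraction`, route SAWCutPointCondensation copy** (the same item
stmt-CriticalPhenomena-4655 is shared verbatim by the two routes; this is the decl of the
cut-point route, proved by the Edwards-route theorem since the two definitions unfold to the same
statement). -/
theorem scheduleExtraction_cutPointCondensation_proof :
    Summit.CriticalPhenomena.SAWScalingLimit.Theses.SAWCutPointCondensation.ScheduleExtraction :=
  scheduleExtraction_proof

end Summit.CriticalPhenomena.SAWScalingLimit.Theorems
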